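import Summits.MatrixMultiplication.MatrixMultiplication.Theorems.AbelianSTPPCensusTAStatFDefs

/-!
# T_A static certificate, range `6780 … 6833` (t*-indexed linear checker with the k-member tree at `τ = 2371/1000`): kernel evaluation, the shape checks of tree-heavy volumes on order sub-ranges re-cut to ≤ 1.2·10⁴ tree nodes (one theorem per (volume, sub-range): bounded kernel memory)

Cell mm-stpp (rung F-M1), tier T_A = «beat `2.371`, the record exponent (ADVXXZ'25 / DEK+26 rounded)»; checker in `AbelianSTPPCensusTAStatFDefs.lean`, table and bucket lists in `AbelianSTPPCensusTAStatFData.lean`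
(pattern: theory g12's `AbelianSTPPCensusTAStatDDom*/DCk*.lean`).  `decide` with kernel reduction (standard axioms; no `native_decide`), `Elab.async false`;
consumed by `TAStatF.checkV_sound` / `TAStatF.domV_sound` / `TAStatF.m2V_sound` in the leaf `AbelianSTPPCensusLeafTA6833Closed.lean`.
WHAT THIS IS NOT: arithmetic on shape lists only; no statement about STPP families or `ω`.
-/

set_option linter.dupNamespace false
set_option autoImplicit false
set_option Elab.async false

namespace Summit.MatrixMultiplication.MatrixMultiplication.Theorems.TAStatF

set_option maxHeartbeats 0 in
/-- Heavy volume `4032` (87 shapes; 523877 tree nodes over all orders), orders `6787 … 6787`: every sorted candidate shape passes `checkShape 6787 6787`. [original] -/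
theorem ck4032s7 : TAStatF.checkV 6787 6787 1 4032 = true := by decide +kernel

set_option maxHeartbeats 0 in
/-- Heavy volume `4032` (87 shapes; 523877 tree nodes over all orders), orders `6788 … 6788`: every sorted candidate shape passes `checkShape 6788 6788`. [original] -/
theorem ck4032s8 : TAStatF.checkV 6788 6788 1 4032 = true := by decide +kernel

set_option maxHeartbeats 0 in
/-- Heavy volume `4032` (87 shapes; 523877 tree nodes over all orders), orders `6789 … 6789`: every sorted candidate shape passes `checkShape 6789 6789`. [original] -/
theorem ck4032s9 : TAStatF.checkV 6789 6789 1 4032 = true := by decide +kernel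

set_option maxHeartbeats 0 in
/-- Heavy volume `4032` (87 shapes; 523877 tree nodes over all orders), orders `6790 … 6790`: every sorted candidate shape passes `checkShape 6790 6790`. [original] -/
theorem ck4032s10 : TAStatF.checkV 6790 6790 1 4032 = true := by decide +kernel

end Summit.MatrixMultiplication.MatrixMultiplication.Theorems.TAStatF
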